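import Literature.Probability.LatticeModels.InnerFacesHoleFree
import HarnessLib

/-!
# Hole cells of an edge set drawn in a Jordan domain lie inside the domain
(line `fk-anchor-transfer`, crux `IsingBoundaryRatio`, stmt-CriticalPhenomena-10650; helper file of the stub
`windowRectPresentation_holds`)

A variant of `InnerFacesHoleFree.lean` (whose proof we follow line by line). Let `D` be a Jordan domain,
`δ > 0`, and let `H` be a finite set of faces of `δℤ²` (a "hole") with the closure property: whenever a face
`a ∈ H` is side-adjacent to a face `b ∉ H`, every common corner of `a` and `b` has its mesh point in `D`
and the common side lies in `closure D` (in the application: the sides through which one cannot leave `H`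
are edges of the mesh graph `Ω_δ`). Then:

* `disjoint_cell_exterior_of_hole` — no open cell of `H` meets the exterior `(closure D)ᶜ` (a path in the
  exterior from such a point to far away has a last time in the union `K` of the closed cells of `H`; the
  point reached is in an open cell, on an open side or at a vertex of `K`; open cells, open rectangles
  across sides between two `H`-faces and open squares about vertices all of whose faces are in `H` are open
  in `K`, contradicting "last time"; a side towards a non-`H` face lies in `closure D` and a vertex with a
  non-`H` face around it is a common corner of an `H`-face and an adjacent non-`H`-face, hence in `D` —
  impossible in the exterior);
* `meshPoint_corner_mem_of_hole` — every corner of a face of `H` has its mesh point in `D`;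
* `meshGraph_adj_of_hole` — the sides of the faces of `H` are mesh edges;
* `exists_reachable_exit_of_hole` — every corner of a face of `H` is joined, in the mesh graph on mesh
  vertices, to a common corner of some `H`-face and an adjacent non-`H`-face (walk east).

The Jordan curve theorem enters through `JordanDomain.exterior_of_JCT` (proved in the tree). [folklore]
-/

noncomputable section

open Set Metric Complex SimpleGraph Literature.Probability.RandomPlanarGeometry Literature.Probability.LatticeModels
  Literature.Probability.LatticeModels.Mesh

namespace Summit.CriticalPhenomena.SAWScalingLimit.Theorems.IsingBoundaryRatio

namespace WindowRect

variable (D : JordanDomain) {δ : ℝ} (hδ : 0 < δ) {H : Set (Site 2)} (hHfin : H.Finite)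
  (hH : ∀ a ∈ H, ∀ b ∉ H, (zdGraph 2).Adj a b → ∀ v : Site 2, IsCorner v a → IsCorner v b →
    meshPoint δ v ∈ D.carrier ∧ ∀ w : Site 2, IsCorner w a → IsCorner w b → (zdGraph 2).Adj v w →
      segment ℝ (meshPoint δ v) (meshPoint δ w) ⊆ closure D.carrier)

include hδ hHfin hH

/-- **No open cell of a hole face meets the exterior of the Jordan domain.** [folklore] -/
theorem disjoint_cell_exterior_of_hole {r : Site 2} (hr : r ∈ H) :
    Disjoint (cell δ (r 0) (r 1)) (closure D.carrier)ᶜ := by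
  classical
  obtain ⟨hVconn, hVfr, hVunb⟩ := D.exterior_of_JCT Literature.Topology.PlaneTopology.JordanCurveTheorem_holds
  set V : Set ℂ := (closure D.carrier)ᶜ with hV
  have hVopen : IsOpen V := isClosed_closure.isOpen_compl
  rw [Set.disjoint_left]
  intro x hx hxV
  -- the union of closed cells of `H`
  set K := cellUnion δ H with hK
  have hKcl : IsClosed K := isClosed_cellUnion δ hHfin
  have hKbdd : Bornology.IsBounded K := isBounded_cellUnion hδ hHfin
  have hrK : ∀ r' ∈ H, closure (cell δ (r' 0) (r' 1)) ⊆ K := fun r' hr' => closure_cell_subset_cellUnion hr'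
  -- a point of `V` outside `K`
  obtain ⟨ρ, hρ⟩ := hKbdd.subset_closedBall 0
  obtain ⟨w, hwV, hwK⟩ : ∃ w ∈ V, w ∉ K := by
    by_contra hall
    push Not at hall
    exact hVunb ((Metric.isBounded_closedBall (x := (0 : ℂ)) (r := ρ)).subset fun w hw => hρ (hall w hw))
  -- a path in `V` from `x` to `w`, and its last time in `K`
  have hpc : IsPathConnected V := (hVopen.isConnected_iff_isPathConnected).1 hVconn
  obtain ⟨γ, hγV⟩ := hpc.joinedIn x hxV w hwV
  set T : Set ℝ := Icc (0 : ℝ) 1 ∩ γ.extend ⁻¹' K with hT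
  have hTcl : IsClosed T := isClosed_Icc.inter (hKcl.preimage γ.continuous_extend)
  have h0T : (0 : ℝ) ∈ T := by
    refine ⟨⟨le_rfl, zero_le_one⟩, ?_⟩
    show γ.extend 0 ∈ K
    rw [γ.extend_zero]
    exact hrK r hr (subset_closure hx)
  have hTbdd : BddAbove T := ⟨1, fun t ht => ht.1.2⟩
  set t₀ := sSup T with ht₀
  have ht₀T : t₀ ∈ T := hTcl.csSup_mem ⟨0, h0T⟩ hTbdd
  have ht₀le : t₀ ≤ 1 := ht₀T.1.2
  have ht₀K : γ.extend t₀ ∈ K := ht₀T.2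
  have ht₀lt : t₀ < 1 := by
    rcases ht₀le.lt_or_eq with h | h
    · exact h
    · exfalso; rw [h, γ.extend_one] at ht₀K; exact hwK ht₀K
  set z := γ.extend t₀ with hz
  have hzV : z ∈ V := by rw [hz, γ.extend_apply ht₀T.1]; exact hγV _
  -- no open neighbourhood of `z` lies in `K`
  have key : ∀ U : Set ℂ, IsOpen U → z ∈ U → U ⊆ K → False := by
    intro U hU hzU hUK
    obtain ⟨t', ht', ht'1, ht'U⟩ := exists_gt_mem_of_continuous γ.continuous_extend ht₀lt hU hzU
    have ht'T : t' ∈ T := ⟨⟨ht₀T.1.1.trans ht'.le, ht'1⟩, hUK ht'U⟩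
    exact absurd (le_csSup hTbdd ht'T) (not_le.2 ht')
  have hzΩ : z ∉ closure D.carrier := hzV
  -- `z` lies in a closed cell of `H`
  obtain ⟨r', hr'R, hzr'⟩ : ∃ r' ∈ H, z ∈ closure (cell δ (r' 0) (r' 1)) := by
    simpa only [hK, cellUnion, Set.mem_iUnion, exists_prop] using ht₀K
  -- closure property of `H`, in the two forms used below
  have hclseg : ∀ {a b : Site 2}, a ∈ H → (zdGraph 2).Adj a b → b ∉ H → ∀ {v w : Site 2},
      IsCorner v a → IsCorner v b → IsCorner w a → IsCorner w b → (zdGraph 2).Adj v w →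
      segment ℝ (meshPoint δ v) (meshPoint δ w) ⊆ closure D.carrier :=
    fun {a b} ha hab hb {v w} hva hvb hwa hwb hvw => (hH a ha b hb hab v hva hvb).2 w hwa hwb hvw
  have hclpt : ∀ {a b : Site 2}, a ∈ H → (zdGraph 2).Adj a b → b ∉ H → ∀ {v : Site 2},
      IsCorner v a → IsCorner v b → meshPoint δ v ∈ D.carrier :=
    fun {a b} ha hab hb {v} hva hvb => (hH a ha b hb hab v hva hvb).1
  set k := r' 0 with hk
  set j := r' 1 with hj
  rw [closure_cell hδ, mem_reProdIm] at hzr'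
  obtain ⟨hre, him⟩ := hzr'
  have hδk : δ * k < δ * (k + 1) := by nlinarith
  have hδj : δ * j < δ * (j + 1) := by nlinarith
  by_cases hreo : z.re ∈ Ioo (δ * k) (δ * (k + 1))
  · by_cases himo : z.im ∈ Ioo (δ * j) (δ * (j + 1))
    · -- in the open cell
      exact key _ (isOpen_cell δ k j) ⟨hreo, himo⟩ ((subset_closure).trans (hrK r' hr'R))
    · -- on a horizontal open side: `z.im = δ j₀`, `j₀ ∈ {j, j + 1}`
      obtain ⟨j₀, hj₀, hlow, hup⟩ : ∃ j₀ : ℤ, z.im = δ * j₀ ∧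
          ((![k, j₀ - 1] : Site 2) ∈ H ∨ (![k, j₀] : Site 2) ∈ H) ∧
          (zdGraph 2).Adj (![k, j₀ - 1] : Site 2) ![k, j₀] := by
        have hr'eq : r' = ![k, j] := funext fun i => by fin_cases i <;> simp [hk, hj]
        have hadj : ∀ j₀ : ℤ, (zdGraph 2).Adj (![k, j₀ - 1] : Site 2) ![k, j₀] := fun j₀ => by
          convert zdGraph_adj_add_cornerUnit (![k, j₀ - 1] : Site 2) 1 using 1
          exact funext fun i => by fin_cases i <;> simp
        rcases eq_or_eq_of_mem_Icc_of_not_mem_Ioo him himo with h | h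
        · refine ⟨j, h, Or.inr ?_, hadj j⟩; rw [← hr'eq]; exact hr'R
        · refine ⟨j + 1, by rw [h]; push_cast; ring, Or.inl ?_, hadj (j + 1)⟩
          rw [show (j + 1 - 1 : ℤ) = j by ring, ← hr'eq]; exact hr'R
      -- the two corners of that side
      have hc : ∀ f : Site 2, f = ![k, j₀ - 1] ∨ f = ![k, j₀] →
          IsCorner ![k, j₀] f ∧ IsCorner ![k + 1, j₀] f := by
        rintro f (rfl | rfl) <;> constructor <;> refine isCorner_of_coords ?_ ?_ <;> simp
      have hvadj : (zdGraph 2).Adj (![k, j₀] : Site 2) ![k + 1, j₀] := by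
        convert zdGraph_adj_add_cornerUnit (![k, j₀] : Site 2) 0 using 1
        exact funext fun i => by fin_cases i <;> simp
      have hzseg : z ∈ segment ℝ (meshPoint δ ![k, j₀]) (meshPoint δ ![k + 1, j₀]) := by
        rw [meshPoint_vec, meshPoint_vec]; push_cast
        exact mem_segment_of_im_eq hδk hre hj₀
      -- if both faces are in `H`, an open rectangle around `z` lies in `K`
      by_cases hboth : (![k, j₀ - 1] : Site 2) ∈ H ∧ (![k, j₀] : Site 2) ∈ H
      · refine key _ (isOpen_Ioo.reProdIm isOpen_Ioo) ?_ ((rect_subset_closure_cells_h hδ k j₀).trans ?_)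
        · rw [mem_reProdIm]; refine ⟨hreo, ?_, ?_⟩ <;> rw [hj₀] <;> nlinarith
        · refine Set.union_subset ?_ ?_
          · have := hrK _ hboth.1; simpa using this
          · have := hrK _ hboth.2; simpa using this
      · -- otherwise `z` lies on the common side of an `H`-face and a non-`H`-face
        have hseg : segment ℝ (meshPoint δ ![k, j₀]) (meshPoint δ ![k + 1, j₀]) ⊆ closure D.carrier := by
          have hc1 := hc _ (Or.inl rfl)
          have hc2 := hc _ (Or.inr rfl)
          rcases hlow with h | h
          · exact hclseg h hup (fun h' => hboth ⟨h, h'⟩) hc1.1 hc2.1 hc1.2 hc2.2 hvadj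
          · exact hclseg h hup.symm (fun h' => hboth ⟨h', h⟩) hc2.1 hc1.1 hc2.2 hc1.2 hvadj
        exact hzΩ (hseg hzseg)
  · -- `z.re = δ k₀`, `k₀ ∈ {k, k + 1}`
    obtain ⟨k₀, hk₀, hk₀'⟩ : ∃ k₀ : ℤ, z.re = δ * k₀ ∧ (k₀ = k ∨ k₀ = k + 1) := by
      rcases eq_or_eq_of_mem_Icc_of_not_mem_Ioo hre hreo with h | h
      · exact ⟨k, h, Or.inl rfl⟩
      · exact ⟨k + 1, by rw [h]; push_cast; ring, Or.inr rfl⟩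
    by_cases himo : z.im ∈ Ioo (δ * j) (δ * (j + 1))
    · -- on a vertical open side between `![k₀ - 1, j]` and `![k₀, j]`
      have hlow : (![k₀ - 1, j] : Site 2) ∈ H ∨ (![k₀, j] : Site 2) ∈ H := by
        have hr'eq : r' = ![k, j] := funext fun i => by fin_cases i <;> simp [hk, hj]
        rcases hk₀' with rfl | rfl
        · right; rw [← hr'eq]; exact hr'R
        · left; rw [show (k + 1 - 1 : ℤ) = k by ring, ← hr'eq]; exact hr'R
      have hup : (zdGraph 2).Adj (![k₀ - 1, j] : Site 2) ![k₀, j] := by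
        convert zdGraph_adj_add_cornerUnit (![k₀ - 1, j] : Site 2) 0 using 1
        exact funext fun i => by fin_cases i <;> simp
      have hc : ∀ f : Site 2, f = ![k₀ - 1, j] ∨ f = ![k₀, j] →
          IsCorner ![k₀, j] f ∧ IsCorner ![k₀, j + 1] f := by
        rintro f (rfl | rfl) <;> constructor <;> refine isCorner_of_coords ?_ ?_ <;> simp
      have hvadj : (zdGraph 2).Adj (![k₀, j] : Site 2) ![k₀, j + 1] := by
        convert zdGraph_adj_add_cornerUnit (![k₀, j] : Site 2) 1 using 1
        exact funext fun i => by fin_cases i <;> simp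
      have hzseg : z ∈ segment ℝ (meshPoint δ ![k₀, j]) (meshPoint δ ![k₀, j + 1]) := by
        rw [meshPoint_vec, meshPoint_vec]; push_cast
        exact mem_segment_of_re_eq hδj him hk₀
      by_cases hboth : (![k₀ - 1, j] : Site 2) ∈ H ∧ (![k₀, j] : Site 2) ∈ H
      · refine key _ (isOpen_Ioo.reProdIm isOpen_Ioo) ?_ ((rect_subset_closure_cells_v hδ k₀ j).trans ?_)
        · rw [mem_reProdIm]; refine ⟨⟨?_, ?_⟩, himo⟩ <;> rw [hk₀] <;> nlinarith
        · refine Set.union_subset ?_ ?_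
          · have := hrK _ hboth.1; simpa using this
          · have := hrK _ hboth.2; simpa using this
      · have hseg : segment ℝ (meshPoint δ ![k₀, j]) (meshPoint δ ![k₀, j + 1]) ⊆ closure D.carrier := by
          have hc1 := hc _ (Or.inl rfl)
          have hc2 := hc _ (Or.inr rfl)
          rcases hlow with h | h
          · exact hclseg h hup (fun h' => hboth ⟨h, h'⟩) hc1.1 hc2.1 hc1.2 hc2.2 hvadj
          · exact hclseg h hup.symm (fun h' => hboth ⟨h', h⟩) hc2.1 hc1.1 hc2.2 hc1.2 hvadj
        exact hzΩ (hseg hzseg)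
    · -- at a vertex `v = ![k₀, j₀]`
      obtain ⟨j₀, hj₀, hj₀'⟩ : ∃ j₀ : ℤ, z.im = δ * j₀ ∧ (j₀ = j ∨ j₀ = j + 1) := by
        rcases eq_or_eq_of_mem_Icc_of_not_mem_Ioo him himo with h | h
        · exact ⟨j, h, Or.inl rfl⟩
        · exact ⟨j + 1, by rw [h]; push_cast; ring, Or.inr rfl⟩
      set v : Site 2 := ![k₀, j₀] with hv
      have hzv : z = meshPoint δ v := by rw [hv, meshPoint_vec]; exact Complex.ext hk₀ hj₀
      have hr'c : IsCorner v r' := by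
        refine isCorner_of_coords ?_ ?_
        · simp only [hv, Matrix.cons_val_zero]; rcases hk₀' with h | h <;> omega
        · simp only [hv, Matrix.cons_val_one, Matrix.cons_val_zero]; rcases hj₀' with h | h <;> omega
      obtain ⟨i₀, hi₀⟩ := exists_faceAt_of_isCorner hr'c
      by_cases hall : ∀ i : Fin 4, faceAt v i ∈ H
      · -- the open square around `v` lies in `K`
        refine key _ (isOpen_Ioo.reProdIm isOpen_Ioo) ?_ ((square_subset_closure_cells hδ k₀ j₀).trans ?_)
        · rw [mem_reProdIm]; refine ⟨⟨?_, ?_⟩, ?_, ?_⟩ <;> simp only [hk₀, hj₀] <;> nlinarith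
        · have h0 := hrK _ (hall 0); have h1 := hrK _ (hall 1); have h2 := hrK _ (hall 2); have h3 := hrK _ (hall 3)
          simp only [faceAt, hv, cornerOff, Pi.sub_apply, Matrix.cons_val_zero, Matrix.cons_val_one,
            Pi.add_apply, Pi.single_eq_same, Pi.single_eq_of_ne (show (1 : Fin 2) ≠ 0 by decide),
            Pi.single_eq_of_ne (show (0 : Fin 2) ≠ 1 by decide), sub_zero, Pi.zero_apply] at h0 h1 h2 h3
          refine Set.union_subset (Set.union_subset ?_ ?_) (Set.union_subset ?_ ?_)
          · simpa using h2
          · simpa using h3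
          · simpa using h1
          · simpa using h0
      · -- some face around `v` is not in `H`: the next one after an `H`-face gives `v ∈ D`
        push Not at hall
        have hstep : ∃ i : Fin 4, faceAt v i ∈ H ∧ faceAt v (i + 1) ∉ H := by
          by_contra hno
          push Not at hno
          obtain ⟨i₁, hi₁⟩ := hall
          have h0 : faceAt v i₀ ∈ H := hi₀ ▸ hr'R
          have h1 := hno _ h0
          have h2 := hno _ h1
          have h3 := hno _ h2
          have : i₁ = i₀ ∨ i₁ = i₀ + 1 ∨ i₁ = i₀ + 1 + 1 ∨ i₁ = i₀ + 1 + 1 + 1 := by omega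
          rcases this with rfl | rfl | rfl | rfl
          · exact hi₁ h0
          · exact hi₁ h1
          · exact hi₁ h2
          · exact hi₁ h3
        obtain ⟨i, hiR, hiR'⟩ := hstep
        have hvΩ : meshPoint δ v ∈ D.carrier :=
          hclpt hiR (by rw [faceAt_succ_eq]; exact zdGraph_adj_add_cornerUnit _ _) hiR'
            (isCorner_faceAt v i) (isCorner_faceAt v (i + 1))
        exact hzΩ (hzv ▸ subset_closure hvΩ)

/-- Hence the closed cell of a hole face lies in `closure D`. [folklore] -/
theorem closure_cell_subset_of_hole {r : Site 2} (hr : r ∈ H) :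
    closure (cell δ (r 0) (r 1)) ⊆ closure D.carrier := by
  refine (closure_mono fun x hx => ?_).trans (by rw [closure_closure])
  by_contra hxV
  exact Set.disjoint_left.1 (disjoint_cell_exterior_of_hole D hδ hHfin hH hr) hx hxV

/-- **Every corner of a hole face has its mesh point in `D`.** [folklore] -/
theorem meshPoint_corner_mem_of_hole {r : Site 2} (hr : r ∈ H) {v : Site 2} (hv : IsCorner v r) :
    meshPoint δ v ∈ D.carrier := by
  by_contra hvΩ
  -- `v` is a frontier point, so some cell cornered at `v` contains exterior points
  have hvcl : meshPoint δ v ∈ closure D.carrier :=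
    closure_cell_subset_of_hole D hδ hHfin hH hr (meshPoint_mem_closure_cell_of_isCorner hδ hv)
  have hvfr : meshPoint δ v ∈ frontier D.carrier := mem_frontier_of_mem_closure D.isOpen hvcl hvΩ
  have hJE : frontier D.carrier ⊆ closure (closure D.carrier)ᶜ :=
    D.frontier_subset_closure_exterior Literature.Topology.PlaneTopology.JordanCurveTheorem_holds
  obtain ⟨k', j', x, hk', hj', hxcell, hxV, -⟩ := exists_exterior_cell_near hδ (hJE hvfr)
  set f : Site 2 := ![k', j'] with hf
  have hfc : IsCorner v f := isCorner_of_coords (by simp [hf, hk']) (by simp [hf, hj'])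
  obtain ⟨i₁, hi₁⟩ := exists_faceAt_of_isCorner hfc
  obtain ⟨i₀, hi₀⟩ := exists_faceAt_of_isCorner hv
  -- all faces at `v` are in `H` (a transition would put `v` in `D`)
  have hstep : ∀ i : Fin 4, faceAt v i ∈ H → faceAt v (i + 1) ∈ H := fun i hi => by
    by_contra hi'
    exact hvΩ ((hH _ hi _ hi' (by rw [faceAt_succ_eq]; exact zdGraph_adj_add_cornerUnit _ _) v
      (isCorner_faceAt v i) (isCorner_faceAt v (i + 1))).1)
  have h0 : faceAt v i₀ ∈ H := hi₀ ▸ hr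
  have h1 := hstep _ h0
  have h2 := hstep _ h1
  have h3 := hstep _ h2
  have hfR : f ∈ H := by
    rw [hi₁]
    have : i₁ = i₀ ∨ i₁ = i₀ + 1 ∨ i₁ = i₀ + 1 + 1 ∨ i₁ = i₀ + 1 + 1 + 1 := by omega
    rcases this with rfl | rfl | rfl | rfl
    · exact h0
    · exact h1
    · exact h2
    · exact h3
  have hdis := disjoint_cell_exterior_of_hole D hδ hHfin hH hfR
  have hx' : x ∈ cell δ (f 0) (f 1) := by simpa [hf] using hxcell
  exact Set.disjoint_left.1 hdis hx' hxV

/-- The sides of a hole face are mesh edges. [folklore] -/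
theorem meshGraph_adj_of_hole {r : Site 2} (hr : r ∈ H) {v w : Site 2} (hv : IsCorner v r) (hw : IsCorner w r)
    (hadj : (zdGraph 2).Adj v w) : (meshGraph D.carrier δ).Adj v w :=
  meshGraph_adj_iff.2 ⟨hadj, (segment_subset_closure_cell_of_isCorner hδ hv hw).trans
    (closure_cell_subset_of_hole D hδ hHfin hH hr)⟩

/-- All corners of a hole face are joined, in the mesh graph on mesh vertices, to its lower-left corner.
[folklore] -/
theorem reachable_corners_of_hole {r : Site 2} (hr : r ∈ H) {v : Site 2} (hv : IsCorner v r) :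
    ∃ (h₁ : r ∈ meshVertices D.carrier δ) (h₂ : v ∈ meshVertices D.carrier δ),
      (meshVertexGraph D.carrier δ).Reachable ⟨r, h₁⟩ ⟨v, h₂⟩ := by
  have hmem : ∀ u, IsCorner u r → u ∈ meshVertices D.carrier δ := fun u hu =>
    meshPoint_corner_mem_of_hole D hδ hHfin hH hr hu
  have hrc : IsCorner r r := isCorner_self r
  refine ⟨hmem r hrc, hmem v hv, ?_⟩
  obtain ⟨a, b, rfl⟩ := exists_corner_eq_of_isCorner hv
  have hcor : ∀ a b : Bool, IsCorner (Mesh.corner (r 0) (r 1) a b) r := fun a b =>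
    isCorner_of_coords (by cases a <;> simp) (by cases b <;> simp)
  have hr0 : r = Mesh.corner (r 0) (r 1) false false := funext fun i => by fin_cases i <;> simp
  have step1 : (meshVertexGraph D.carrier δ).Reachable ⟨r, hmem r hrc⟩
      ⟨Mesh.corner (r 0) (r 1) a false, hmem _ (hcor a false)⟩ := by
    cases a
    · have : (⟨r, hmem r hrc⟩ : meshVertices D.carrier δ) =
          ⟨Mesh.corner (r 0) (r 1) false false, hmem _ (hcor false false)⟩ := Subtype.ext hr0
      rw [this]
    · refine SimpleGraph.Adj.reachable ((meshVertexGraph_adj_iff _ _).2 ?_)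
      have := meshGraph_adj_of_hole D hδ hHfin hH hr (hcor false false) (hcor true false)
        (zdGraph_adj_corner_horizontal _ _ false)
      rwa [← hr0] at this
  refine step1.trans ?_
  cases b
  · exact Reachable.refl _
  · exact SimpleGraph.Adj.reachable ((meshVertexGraph_adj_iff _ _).2
      (meshGraph_adj_of_hole D hδ hHfin hH hr (hcor a false) (hcor a true) (zdGraph_adj_corner_vertical _ _ a)))

/-- **Walking east out of the hole.** Every corner of a hole face is joined, in the mesh graph on mesh
vertices, to a common corner of a hole face and a side-adjacent face outside the hole. [folklore] -/
theorem exists_reachable_exit_of_hole {r : Site 2} (hr : r ∈ H) {v : Site 2} (hv : IsCorner v r) :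
    ∃ a b u : Site 2, a ∈ H ∧ b ∉ H ∧ (zdGraph 2).Adj a b ∧ IsCorner u a ∧ IsCorner u b ∧
      ∃ (h₁ : v ∈ meshVertices D.carrier δ) (h₂ : u ∈ meshVertices D.carrier δ),
        (meshVertexGraph D.carrier δ).Reachable ⟨v, h₁⟩ ⟨u, h₂⟩ := by
  classical
  -- some face east of `r` is outside `H`
  have hex : ∃ n : ℕ, r + n • cornerUnit 0 ∉ H := by
    by_contra hall
    push Not at hall
    obtain ⟨m, n, hmn, h⟩ := hHfin.exists_lt_map_eq_of_forall_mem hall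
    have := congrFun h 0
    rw [add_nsmul_cornerUnit_apply, add_nsmul_cornerUnit_apply] at this
    simp at this
    omega
  have hN := Nat.find_spec hex
  obtain ⟨m, hm⟩ : ∃ m, Nat.find hex = m + 1 := by
    refine ⟨Nat.find hex - 1, ?_⟩
    have h0 : Nat.find hex ≠ 0 := fun h0 => by rw [h0] at hN; simp at hN; exact hN hr
    omega
  have hmem : ∀ i ≤ m, r + i • cornerUnit 0 ∈ H := fun i hi => by
    have := Nat.find_min hex (m := i) (by omega)
    simpa using this
  set a := r + m • cornerUnit 0 with ha
  have haH : a ∈ H := hmem m le_rfl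
  have hbH : a + cornerUnit 0 ∉ H := by rw [ha, ← add_succ_nsmul_cornerUnit, ← hm]; exact hN
  -- the common corner `a + e₀`
  have hua : IsCorner (a + cornerUnit 0) a := by
    have := isCorner_faceAt (a + cornerOff 1) 1
    rwa [faceAt_add_cornerOff, cornerOff_one_eq_cornerUnit_zero] at this
  refine ⟨a, a + cornerUnit 0, a + cornerUnit 0, haH, hbH, zdGraph_adj_add_cornerUnit _ _, hua, isCorner_self _, ?_⟩
  -- reachability: `v ~ r ~ r + e₀ ~ ⋯ ~ a ~ a + e₀`
  obtain ⟨h₁, h₂, hvr⟩ := reachable_corners_of_hole D hδ hHfin hH hr hv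
  have chain : ∀ i ≤ m, ∃ (h₃ : r + i • cornerUnit 0 ∈ meshVertices D.carrier δ),
      (meshVertexGraph D.carrier δ).Reachable ⟨r, h₁⟩ ⟨r + i • cornerUnit 0, h₃⟩ := by
    intro i
    induction i with
    | zero => intro; exact ⟨by simpa using h₁, by simp⟩
    | succ i ih =>
      intro hi
      obtain ⟨h₃, hreach⟩ := ih (by omega)
      have hc : IsCorner (r + i • cornerUnit 0 + cornerUnit 0) (r + i • cornerUnit 0) := by
        have := isCorner_faceAt (r + i • cornerUnit 0 + cornerOff 1) 1
        rwa [faceAt_add_cornerOff, cornerOff_one_eq_cornerUnit_zero] at this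
      obtain ⟨_, h₄, hreach'⟩ := reachable_corners_of_hole D hδ hHfin hH (hmem i (by omega)) hc
      refine ⟨by rw [add_succ_nsmul_cornerUnit]; exact h₄, ?_⟩
      have : (⟨r + (i + 1) • cornerUnit 0, by rw [add_succ_nsmul_cornerUnit]; exact h₄⟩ : meshVertices D.carrier δ) =
          ⟨r + i • cornerUnit 0 + cornerUnit 0, h₄⟩ := Subtype.ext (add_succ_nsmul_cornerUnit _ _ _)
      rw [this]
      exact hreach.trans hreach'
  obtain ⟨h₃, hra⟩ := chain m le_rfl
  obtain ⟨_, h₄, hau⟩ := reachable_corners_of_hole D hδ hHfin hH haH hua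
  exact ⟨h₂, h₄, hvr.symm.trans (hra.trans hau)⟩

end WindowRect

/-- **Every corner of a hole face lies in the Jordan domain**, closed form (registered sub-goal of
stmt-CriticalPhenomena-10650). [folklore] -/
theorem windowRect_meshPoint_corner_mem_of_hole : ∀ (D : Literature.Probability.RandomPlanarGeometry.JordanDomain) {δ : ℝ}, 0 < δ → ∀ {H : Set (Site 2)}, H.Finite → (∀ a ∈ H, ∀ b ∉ H, (zdGraph 2).Adj a b → ∀ v : Site 2, IsCorner v a → IsCorner v b → meshPoint δ v ∈ D.carrier ∧ ∀ w : Site 2, IsCorner w a → IsCorner w b → (zdGraph 2).Adj v w → segment ℝ (meshPoint δ v) (meshPoint δ w) ⊆ closure D.carrier) → ∀ {r : Site 2}, r ∈ H → ∀ {v : Site 2}, IsCorner v r → meshPoint δ v ∈ D.carrier :=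
  fun D _ hδ _ hHfin hH _ hr _ hv => WindowRect.meshPoint_corner_mem_of_hole D hδ hHfin hH hr hv

end Summit.CriticalPhenomena.SAWScalingLimit.Theorems.IsingBoundaryRatio

end
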